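import Summits.AnomalousDissipation.AnomalousDissipation.Theses.TwoAndHalfD
import Summits.AnomalousDissipation.AnomalousDissipation.Theorems.TwoAndHalfDTwohalfdThesisStubLogGate
import Literature.Analysis.FluidPDE.PassiveScalarClassicalEnergy

/-!
# The quantitative log gate `stub_logGateQuantitative` (line `Sketch`, crux stmt-AnomalousDissipation-0206)

Registered stub of the line `Sketch` (duhamel-release) for the crux
`Summit.AnomalousDissipation.AnomalousDissipation.Theses.TwoAndHalfD.TwohalfdThesis`
(stmt-AnomalousDissipation-0206): the quantitative single-release core of the log gate
`releaseEnvelope_false_of_gradient_bound` (`TwoAndHalfDTwohalfdThesisStubLogGate`).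

CONTENT. Let `φ` be a classical release of a smooth pattern `h` into a drift `u` with diffusivity
`κ ≥ 0` on the window `[s, s + τ₀] × 𝕋²` (`∂ₜφ + u·∇φ = κΔφ`, `φ(s) = h`;
`Torus.IsClassicalScalarTransportOn`), and let the first derivatives of the drift be bounded on
the window, `‖∂ᵢu(t, x)‖ ≤ L`. Then the `L²` loss over the window obeys
`‖h‖² - ‖φ(s + τ₀)‖² ≤ 2κτ₀ · ‖∇h‖² e^{4|L|τ₀}`.
Read as the log law: a loss `≥ δ‖h‖²` forces `|L| ≥ log(δ‖h‖² / (2κτ₀‖∇h‖²)) / (4τ₀)`.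

PROOF (verbatim the budget step of `releaseEnvelope_false_of_gradient_bound`).
(1) Energy equality (`scalarL2Sq_add_scalarDissipation_holds`):
`‖h‖² - ‖φ(s + τ₀)‖² = 2κ ∫ₛ^{s+τ₀} ‖∇φ(t)‖² dt`.
(2) The exponential `H¹` bound `scalarGradNormSq_le_mul_exp` (with the rate made nonnegative by
upgrading `‖∂ᵢu‖ ≤ L` to `‖∂ᵢu‖ ≤ |L|`):
`‖∇φ(t)‖² ≤ ‖∇h‖² e^{4|L|(t - s)} ≤ ‖∇h‖² e^{4|L|τ₀}` on the window.
(3) Integrate the constant bound over `[s, s + τ₀]` (`intervalIntegral.integral_mono_on`; the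
enstrophy is continuous in time, `continuousOn_scalarGradNormSq`) and insert into (1).
Supports stmt-AnomalousDissipation-0206. [folklore: Batchelor 1959; Miles–Doering,
Nonlinearity 31 (2018), §2; DEIJ 2022, §1]
-/

noncomputable section

-- the summit path `AnomalousDissipation/AnomalousDissipation` duplicates a namespace component
set_option linter.dupNamespace false

namespace Summit.AnomalousDissipation.AnomalousDissipation.Theorems.TwohalfdThesis

open MeasureTheory Set Filter Topology
open scoped ENNReal NNReal InnerProductSpace
open Literature.Analysis.FunctionSpaces Literature.Analysis.FluidPDE

/-- **The quantitative log gate (single release).** For a classical release `φ` of a smooth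
pattern `h` into a drift `u` with diffusivity `κ ≥ 0` on the window `[s, s + τ₀] × 𝕋²`
(`∂ₜφ + u·∇φ = κΔφ`, `φ(s) = h`) whose drift has bounded first derivatives `‖∂ᵢu(t, x)‖ ≤ L`
on the window, the `L²` loss obeys `‖h‖² - ‖φ(s + τ₀)‖² ≤ κ · 2τ₀ · ‖∇h‖² e^{4|L|τ₀}`:
the energy equality `‖h‖² - ‖φ(s + τ₀)‖² = 2κ∫ₛ^{s+τ₀}‖∇φ‖²`, the exponential `H¹` bound
`‖∇φ(t)‖² ≤ ‖∇h‖² e^{4|L|(t - s)} ≤ ‖∇h‖² e^{4|L|τ₀}` on the window, and integration of the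
constant bound. [folklore] -/
theorem stub_logGateQuantitative : ∀ (κ L s τ₀ : ℝ) (u : ℝ → (UnitAddTorus (Fin 2)) → (EuclideanSpace ℝ (Fin 2))) (h : (UnitAddTorus (Fin 2)) → ℝ) (φ : ℝ → (UnitAddTorus (Fin 2)) → ℝ), 0 ≤ κ → 0 < τ₀ → Torus.IsSmooth h → Torus.IsClassicalScalarTransportOn (Icc s (s + τ₀)) κ u φ → φ s = h → (∀ t ∈ Icc s (s + τ₀), ∀ (i : Fin 2) (x : UnitAddTorus (Fin 2)), ‖Torus.partialDeriv i (u t) x‖ ≤ L) → Torus.scalarL2Sq h - Torus.scalarL2Sq (φ (s + τ₀)) ≤ κ * (2 * τ₀ * (Torus.scalarGradNormSq h * Real.exp (4 * |L| * τ₀))) := by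
  intro κ L s τ₀ u h φ hκ hτ₀ _hh hj hj0 hL
  have hab : s < s + τ₀ := by linarith
  set M : ℝ := Torus.scalarGradNormSq h * Real.exp (4 * |L| * τ₀) with hM
  -- (1) the energy equality on the window
  have hen := Torus.IsClassicalScalarTransportOn.scalarL2Sq_add_scalarDissipation_holds hj hab.le
    Subset.rfl
  rw [hj0, Torus.scalarDissipation] at hen
  -- (2) the exponential `H¹` bound, uniformly on the window (nonnegative rate `4|L|`)
  have hL' : ∀ t ∈ Icc s (s + τ₀), ∀ (i : Fin 2) (x : UnitAddTorus (Fin 2)),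
      ‖Torus.partialDeriv i (u t) x‖ ≤ |L| :=
    fun t ht i x => (hL t ht i x).trans (le_abs_self L)
  have hGle : ∀ t ∈ Icc s (s + τ₀), Torus.scalarGradNormSq (φ t) ≤ M := by
    intro t ht
    have h1 := scalarGradNormSq_le_mul_exp hj hκ hab hL' ht
    rw [hj0] at h1
    refine h1.trans (mul_le_mul_of_nonneg_left (Real.exp_le_exp.2 ?_)
      (Torus.scalarGradNormSq_nonneg h))
    have hcard : (Fintype.card (Fin 2) : ℝ) = 2 := by simp
    rw [hcard]
    have hLt : |L| * (t - s) ≤ |L| * τ₀ :=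
      mul_le_mul_of_nonneg_left (by linarith [ht.2]) (abs_nonneg L)
    linarith
  -- (3) integrate the constant bound over the window
  have hGc : ContinuousOn (fun t => Torus.scalarGradNormSq (φ t)) (Icc s (s + τ₀)) :=
    hj.continuousOn_scalarGradNormSq (convex_Icc _ _) (uniqueDiffOn_Icc hab)
  have hGi : IntervalIntegrable (fun t => Torus.scalarGradNormSq (φ t)) volume s (s + τ₀) :=
    (hGc.mono (uIcc_of_le hab.le).subset).intervalIntegrable
  have hint : ∫ t in s..(s + τ₀), Torus.scalarGradNormSq (φ t) ≤ ∫ _t in s..(s + τ₀), M :=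
    intervalIntegral.integral_mono_on hab.le hGi intervalIntegrable_const fun t ht => hGle t ht
  rw [intervalIntegral.integral_const, smul_eq_mul, add_sub_cancel_left] at hint
  -- (4) insert into the energy equality
  have hκint := mul_le_mul_of_nonneg_left hint hκ
  linarith

end Summit.AnomalousDissipation.AnomalousDissipation.Theorems.TwohalfdThesis

end
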